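import Summits.AtomisticToContinuum.HydrodynamicLimit.Theorems.CollisionIsometryCLTMacroClosureStubClausiusCore
import Summits.AtomisticToContinuum.HydrodynamicLimit.Theorems.CollisionIsometryCLTMacroClosureStubClausiusDV
import Summits.AtomisticToContinuum.HydrodynamicLimit.Theorems.CollisionIsometryCLTMacroClosureStubClausiusStatics
import Summits.AtomisticToContinuum.HydrodynamicLimit.Theorems.JParityClosureOddContactSymmetryGibbsInvariance
import HarnessLib

/-!
# Stub `stub_clausius` of the line `IdeatorTwoGen1Sketch` (crux `MacroClosure`, stmt-14870), part 6:
# the fixed-`N`, fixed-`s` inequality in mean on the good event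

Support file (`--supports stmt-AtomisticToContinuum-14870`) for the registered stub
`Barycentric.stub_clausius`; it lands the registered sub-goal `stub_clausius_core`.

`Clausius.core_bound`: fix `N`, a flow `Φ`, a time `s`, a continuous kernel `φ ≥ 0` of mass one bounded
by `Φb < (N+1)c₁`, `f_ex` continuous on `[c₁σ³, 1]`, the homogeneous state `U_c = stateOf 1 u_c θ_c` with
the block MGF bound `∫⁻ exp(γ'(N+1) 𝟙_B ∫ₓ h_σ⁺(Ū|U_c)) dG_N ≤ e^{ε(N+1)}` under the homogeneous law
`G_N = localGibbsLaw σ 1 u_c θ_c`, and a measurable `G ⊆ good` with `Φ_s(G) ⊆ B`. Then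
`z ↦ 𝟙_G(z) ∫ₓ η_σ(Ū(Φ_s z, x)) dx` is integrable under `P = localGibbsLaw σ a₀ u₀ θ₀` and
`E_P[𝟙_G ∫ₓ η_σ(Ū_s)] ≤ (γ'(N+1))⁻¹ (KL(P‖G_N) + ε(N+1)) + E_P[𝟙_G (η_σ(U_c) + Λ_c((1,p,e) − U_c))]`
(invariance of `G_N` under `Φ_s`, the entropy inequality `stub_clausius_dv`, finite `KL(P‖G_N)`,
almost surely distinct velocities, the deterministic core `Clausius.core_pointwise`, conservation of
`p, e`).
-/

noncomputable section

open MeasureTheory Filter Set Topology InformationTheory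
open scoped ENNReal ContDiff

namespace Summit.AtomisticToContinuum.HydrodynamicLimit.Theorems.MacroClosureLine

open Literature.MathematicalPhysics.KineticTheory Literature.Analysis.FluidPDE
open Literature.Analysis.FunctionSpaces

namespace Barycentric

namespace Clausius

variable {N : ℕ}

/-- The per-particle kinetic energy is half the kinetic pairing `⟨emp, |v|²⟩`. [folklore] -/
theorem empiricalEnergyField_one_eq_half_kineticPair (z : Config (N + 1) (Fin 3) T3) :
    empiricalEnergyField z (fun _ => (1 : ℝ)) = 2⁻¹ * ∫ y, ‖y.2‖ ^ 2 ∂(empiricalMeasure z) := by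
  rw [empiricalEnergyField_one, StubLedger.kineticPair_eq_sum, Finset.mul_sum, Finset.mul_sum, Finset.mul_sum]
  push_cast
  refine Finset.sum_congr rfl fun i _ => ?_
  ring

/-- The totals vector `z ↦ (1, p(z), e(z))` is continuous. [folklore] -/
theorem continuous_totals :
    Continuous fun z : Config (N + 1) (Fin 3) T3 =>
      (((1 : ℝ), empiricalMomentumField z (fun _ => (1 : ℝ)), empiricalEnergyField z (fun _ => (1 : ℝ))) : State) := by
  refine continuous_const.prodMk (Continuous.prodMk ?_ ?_)
  · simp_rw [empiricalMomentumField_one]; fun_prop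
  · simp_rw [empiricalEnergyField_one]; fun_prop

/-- Norm of the totals vector: `‖(1, p, e)‖ ≤ 3/2 + 2e`. [folklore] -/
theorem norm_totals_le (z : Config (N + 1) (Fin 3) T3) :
    ‖(((1 : ℝ), empiricalMomentumField z (fun _ => (1 : ℝ)), empiricalEnergyField z (fun _ => (1 : ℝ))) : State)‖ ≤
      3 / 2 + 2 * empiricalEnergyField z (fun _ => (1 : ℝ)) := by
  have he := empiricalEnergyField_one_nonneg z
  have hp := norm_empiricalMomentumField_one_le z
  rw [Prod.norm_mk, Prod.norm_mk]
  refine max_le ?_ (max_le ?_ ?_)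
  · rw [norm_one]; linarith
  · linarith
  · rw [Real.norm_eq_abs, abs_of_nonneg he]; linarith

/-- **The good-event functional is affine in the kinetic energy**:
`|η_σ(U_c) + Λ_c((1,p,e) − U_c)| ≤ |η_σ(U_c)| + ‖Λ_c‖(3/2 + ‖U_c‖) + 2‖Λ_c‖ e`. [folklore] -/
theorem abs_goodFunctional_le (σ : ℝ) (Uc : State) (z : Config (N + 1) (Fin 3) T3) :
    |hsEntropy σ Uc + fderiv ℝ (hsEntropy σ) Uc ((((1 : ℝ), empiricalMomentumField z (fun _ => (1 : ℝ)),
        empiricalEnergyField z (fun _ => (1 : ℝ))) : State) - Uc)| ≤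
      |hsEntropy σ Uc| + ‖fderiv ℝ (hsEntropy σ) Uc‖ * (3 / 2 + ‖Uc‖) +
        2 * ‖fderiv ℝ (hsEntropy σ) Uc‖ * empiricalEnergyField z (fun _ => (1 : ℝ)) := by
  set Λ : State →L[ℝ] ℝ := fderiv ℝ (hsEntropy σ) Uc with hΛ
  set V : State := (((1 : ℝ), empiricalMomentumField z (fun _ => (1 : ℝ)),
    empiricalEnergyField z (fun _ => (1 : ℝ))) : State) with hV
  have h1 : |Λ (V - Uc)| ≤ ‖Λ‖ * ‖V - Uc‖ := by
    rw [← Real.norm_eq_abs]; exact Λ.le_opNorm _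
  have h2 : ‖V - Uc‖ ≤ 3 / 2 + 2 * empiricalEnergyField z (fun _ => (1 : ℝ)) + ‖Uc‖ :=
    (norm_sub_le _ _).trans (add_le_add (norm_totals_le z) le_rfl)
  have h3 : |hsEntropy σ Uc + Λ (V - Uc)| ≤ |hsEntropy σ Uc| + |Λ (V - Uc)| := abs_add_le _ _
  have h4 : ‖Λ‖ * ‖V - Uc‖ ≤ ‖Λ‖ * (3 / 2 + 2 * empiricalEnergyField z (fun _ => (1 : ℝ)) + ‖Uc‖) :=
    mul_le_mul_of_nonneg_left h2 (norm_nonneg _)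
  linarith

/-- **The fixed-`N`, fixed-`s` inequality in mean on the good event.** See the module docstring.
[folklore] -/
theorem core_bound {σ : ℝ} (hσ : 0 < σ) (hσ2 : σ ≤ 1 / 2) {a₀ θ₀ : T3 → ℝ} {u₀ : T3 → V3}
    (ha : Continuous a₀) (hθ : Continuous θ₀) (hu : Continuous u₀) (ha0 : ∀ x, 0 < a₀ x)
    (hθ0 : ∀ x, 0 < θ₀ x) (uc : V3) {θc : ℝ} (hθc : 0 < θc) (Φ : Flow σ N) {c₁ : ℝ} (hc₁ : 0 < c₁)
    (hc₁σ : c₁ * σ ^ 3 ≤ 1) (hfex : ContinuousOn hsExcessFreeEnergy (Icc (c₁ * σ ^ 3) 1)) {φ : T3 → ℝ}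
    (hφc : Continuous φ) (hφ0 : ∀ y, 0 ≤ φ y) (hφ1 : ∫ y, φ y = 1) {Φb : ℝ} (hφb : ∀ y, φ y ≤ Φb)
    (hN : Φb < ((N + 1 : ℕ) : ℝ) * c₁) {γ' ε : ℝ} (hγ' : 0 < γ')
    (hMGF : ∫⁻ z, ENNReal.ofReal (Real.exp (γ' * ((N : ℝ) + 1) *
        {z : Config (N + 1) (Fin 3) T3 | ∀ x, c₁ ≤ bρ φ z x ∧ bρ φ z x * σ ^ 3 ≤ 1}.indicator
          (fun z => ∫ x, max 0 (relEnt σ (bU φ z x) (stateOf 1 uc θc))) z))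
        ∂(localGibbsLaw σ (fun _ => 1) (fun _ => uc) (fun _ => θc) N Φ) ≤
      ENNReal.ofReal (Real.exp (ε * ((N : ℝ) + 1))))
    {G : Set (Config (N + 1) (Fin 3) T3)} (hGm : MeasurableSet G) (hGgood : G ⊆ Φ.good) (s : ℝ)
    (hGband : ∀ z ∈ G, ∀ x, c₁ ≤ bρ φ (Φ.flow s z) x ∧ bρ φ (Φ.flow s z) x * σ ^ 3 ≤ 1) :
    Integrable (fun z => G.indicator (fun z => ∫ x, hsEntropy σ (bU φ (Φ.flow s z) x)) z)
        (localGibbsLaw σ a₀ u₀ θ₀ N Φ) ∧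
    ∫ z, G.indicator (fun z => ∫ x, hsEntropy σ (bU φ (Φ.flow s z) x)) z ∂(localGibbsLaw σ a₀ u₀ θ₀ N Φ) ≤
      (γ' * ((N : ℝ) + 1))⁻¹ * ((klDiv (localGibbsLaw σ a₀ u₀ θ₀ N Φ)
          (localGibbsLaw σ (fun _ => 1) (fun _ => uc) (fun _ => θc) N Φ)).toReal + ε * ((N : ℝ) + 1)) +
      ∫ z, G.indicator (fun z => hsEntropy σ (stateOf 1 uc θc) +
          fderiv ℝ (hsEntropy σ) (stateOf 1 uc θc) ((((1 : ℝ), empiricalMomentumField z (fun _ => (1 : ℝ)),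
            empiricalEnergyField z (fun _ => (1 : ℝ))) : State) - stateOf 1 uc θc)) z
        ∂(localGibbsLaw σ a₀ u₀ θ₀ N Φ) := by
  -- notation
  set P : Measure (Config (N + 1) (Fin 3) T3) := localGibbsLaw σ a₀ u₀ θ₀ N Φ with hP
  set Gm : Measure (Config (N + 1) (Fin 3) T3) :=
    localGibbsLaw σ (fun _ => 1) (fun _ => uc) (fun _ => θc) N Φ with hGmdef
  set T : Config (N + 1) (Fin 3) T3 → Config (N + 1) (Fin 3) T3 := Φ.flow s with hT
  set B : Set (Config (N + 1) (Fin 3) T3) := {w | ∀ x, c₁ ≤ bρ φ w x ∧ bρ φ w x * σ ^ 3 ≤ 1} with hB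
  set Uc : State := stateOf 1 uc θc with hUc
  set Λ : State →L[ℝ] ℝ := fderiv ℝ (hsEntropy σ) Uc with hΛ
  set Tot : Config (N + 1) (Fin 3) T3 → State := fun z =>
    (((1 : ℝ), empiricalMomentumField z (fun _ => (1 : ℝ)), empiricalEnergyField z (fun _ => (1 : ℝ))) : State)
    with hTot
  set S : Config (N + 1) (Fin 3) T3 → ℝ := fun z => hsEntropy σ Uc + Λ (Tot z - Uc) with hS
  set e : Config (N + 1) (Fin 3) T3 → ℝ := fun z => empiricalEnergyField z (fun _ => (1 : ℝ)) with he
  set I : Config (N + 1) (Fin 3) T3 → ℝ := fun z => ∫ x, hsEntropy σ (bU φ (T z) x) with hI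
  set hplus : Config (N + 1) (Fin 3) T3 → ℝ := fun w => ∫ x, max 0 (relEnt σ (bU φ w x) Uc) with hhplus
  set cN : ℝ := γ' * ((N : ℝ) + 1) with hcN
  have hcN0 : 0 < cN := mul_pos hγ' (by positivity)
  haveI hPprob : IsProbabilityMeasure P := isProbabilityMeasure_localGibbsLaw ha hθ hu ha0 hθ0 hσ2 N Φ
  haveI hGprob : IsProbabilityMeasure Gm :=
    isProbabilityMeasure_localGibbsLaw continuous_const continuous_const continuous_const
      (fun _ => one_pos) (fun _ => hθc) hσ2 N Φ
  have hTm : Measurable T := Φ.measurable_flow s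
  -- clamped (measurable) versions of the block functionals
  set clamp : State → State := fun U => ((max c₁ (min U.1 (σ ^ 3)⁻¹), U.2) : State) with hclamp
  set ηc : State → ℝ := fun U => hsEntropy σ (clamp U) with hηc
  set hc : State → ℝ := fun U => max 0 (ηc U - hsEntropy σ Uc - Λ (U - Uc)) with hhc
  have hηcm : Measurable ηc := measurable_hsEntropy_clamp hσ hc₁σ hfex
  have hhcm : Measurable hc :=
    measurable_const.max ((hηcm.sub measurable_const).sub (Λ.measurable.comp (measurable_id.sub measurable_const)))
  have hband_eq : ∀ w ∈ B, ∀ x, clamp (bU φ w x) = bU φ w x := fun w hw x =>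
    clamp_eq_of_band hσ (hw x).1 (hw x).2
  -- measurability of the clamped parametric integrals
  have hIc_m : Measurable fun w : Config (N + 1) (Fin 3) T3 => ∫ x, ηc (bU φ w x) := by
    have hj : Measurable fun p : Config (N + 1) (Fin 3) T3 × T3 => ηc (bU φ p.1 p.2) :=
      hηcm.comp (measurable_bU_prod hφc)
    exact (hj.stronglyMeasurable.integral_prod_right' (ν := volume)).measurable
  have hplusc_m : Measurable fun w : Config (N + 1) (Fin 3) T3 => ∫ x, hc (bU φ w x) := by
    have hj : Measurable fun p : Config (N + 1) (Fin 3) T3 × T3 => hc (bU φ p.1 p.2) :=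
      hhcm.comp (measurable_bU_prod hφc)
    exact (hj.stronglyMeasurable.integral_prod_right' (ν := volume)).measurable
  -- the tilt, in measurable form, and its identification with the tilt of `hMGF`
  set F : Config (N + 1) (Fin 3) T3 → ℝ := fun w => cN * B.indicator (fun w => ∫ x, hc (bU φ w x)) w with hF
  have hBm : MeasurableSet B := measurableSet_band hφc
  have hFm : Measurable F := measurable_const.mul (hplusc_m.indicator hBm)
  have hF0 : ∀ w, 0 ≤ F w := fun w => mul_nonneg hcN0.le
    (Set.indicator_nonneg (fun w _ => integral_nonneg fun x => le_max_left _ _) w)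
  have hplus_eq : ∀ w ∈ B, (∫ x, hc (bU φ w x)) = hplus w := by
    intro w hw
    refine integral_congr_ae (Eventually.of_forall fun x => ?_)
    simp only [hhc, hηc, hband_eq w hw x]
    rfl
  have hF_eq : ∀ w, F w = cN * B.indicator hplus w := by
    intro w
    by_cases hw : w ∈ B
    · simp only [hF, indicator_of_mem hw, hplus_eq w hw]
    · simp only [hF, indicator_of_notMem hw]
  -- Step 1: the entropy inequality with the invariant homogeneous law
  have hKL : klDiv P Gm ≠ ⊤ :=
    klDiv_localGibbsLaw_ne_top hσ2 Φ ha hθ hu continuous_const continuous_const continuous_const ha0 hθ0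
      (fun _ => one_pos) (fun _ => hθc)
  have hMGF' : ∫⁻ z, ENNReal.ofReal (Real.exp (F (T z))) ∂Gm ≤ ENNReal.ofReal (Real.exp (ε * ((N : ℝ) + 1))) := by
    have hmeas : Measurable fun w => ENNReal.ofReal (Real.exp (F w)) := hFm.exp.ennreal_ofReal
    calc ∫⁻ z, ENNReal.ofReal (Real.exp (F (T z))) ∂Gm
        = ∫⁻ w, ENNReal.ofReal (Real.exp (F w)) ∂(Gm.map T) := (lintegral_map hmeas hTm).symm
      _ = ∫⁻ w, ENNReal.ofReal (Real.exp (F w)) ∂Gm := by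
          rw [hGmdef, hT, map_flow_localGibbsLaw_const σ 1 θc uc N Φ s]
      _ = ∫⁻ w, ENNReal.ofReal (Real.exp (cN * B.indicator hplus w)) ∂Gm :=
          lintegral_congr fun w => by rw [hF_eq w]
      _ ≤ ENNReal.ofReal (Real.exp (ε * ((N : ℝ) + 1))) := hMGF
  obtain ⟨hFTint', hFTle'⟩ :=
    integral_le_toReal_klDiv_add_of_nonneg (μ := P) (ν := Gm) hKL (hFm.comp hTm) (fun z => hF0 (T z)) hMGF'
  have hFTint : Integrable (fun z => F (T z)) P := hFTint'
  have hFTle : ∫ z, F (T z) ∂P ≤ (klDiv P Gm).toReal + ε * ((N : ℝ) + 1) := hFTle'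
  -- Step 2: almost sure pointwise bounds from the deterministic core
  have hae := ae_pairwise_vel_ne (N := N) a₀ u₀ θ₀ Φ s
  have hpt : ∀ᵐ z ∂P, z ∈ G →
      -(e z) - 1 ≤ I z ∧ I z ≤ cN⁻¹ * F (T z) + S z ∧ I z = ∫ x, ηc (bU φ (T z) x) := by
    filter_upwards [hae] with z hz hzG
    have hzB : T z ∈ B := hGband z hzG
    obtain ⟨-, hfloor, htel⟩ := core_pointwise hσ hc₁ hfex hφc hφ0 hφ1 hφb hN Uc (T z) hzB hz
    obtain ⟨hpcons, hecons⟩ := totals_flow Φ (hGgood hzG) s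
    refine ⟨?_, ?_, ?_⟩
    · simpa only [he, hT, hecons] using hfloor
    · have hFT : F (T z) = cN * hplus (T z) := by rw [hF_eq, indicator_of_mem hzB]
      have h1 : cN⁻¹ * F (T z) = hplus (T z) := by
        rw [hFT, ← mul_assoc, inv_mul_cancel₀ hcN0.ne', one_mul]
      rw [h1]
      simpa only [hI, hS, hTot, hhplus, hT, hpcons, hecons, add_assoc] using htel
    · simp only [hI, hηc, hband_eq (T z) hzB]
  -- Step 3: integrability of the good-event functional
  have heInt : Integrable e P := by
    have hK := JaynesSqueezeSqueeze.integrable_kineticPair_localGibbsLaw hσ2 ha hθ hu ha0 hθ0 N Φ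
    have : e = fun z => 2⁻¹ * ∫ y, ‖y.2‖ ^ 2 ∂(empiricalMeasure z) :=
      funext fun z => empiricalEnergyField_one_eq_half_kineticPair z
    rw [this]
    exact hK.const_mul _
  have hSm : Measurable S := by
    have : Continuous S := continuous_const.add (Λ.continuous.comp (continuous_totals.sub continuous_const))
    exact this.measurable
  have hSbound : ∀ z, |S z| ≤ |hsEntropy σ Uc| + ‖Λ‖ * (3 / 2 + ‖Uc‖) + 2 * ‖Λ‖ * e z := fun z =>
    abs_goodFunctional_le σ Uc z
  have hSint : Integrable S P := by
    refine Integrable.mono' ((integrable_const (|hsEntropy σ Uc| + ‖Λ‖ * (3 / 2 + ‖Uc‖))).add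
      (heInt.const_mul (2 * ‖Λ‖))) hSm.aestronglyMeasurable (ae_of_all _ fun z => ?_)
    rw [Real.norm_eq_abs]
    simpa only [Pi.add_apply] using hSbound z
  have hGIm : AEStronglyMeasurable (fun z => G.indicator I z) P := by
    have hm : Measurable fun z => G.indicator (fun z => ∫ x, ηc (bU φ (T z) x)) z :=
      (hIc_m.comp hTm).indicator hGm
    refine (hm.aestronglyMeasurable).congr ?_
    filter_upwards [hpt] with z hz
    by_cases hzG : z ∈ G
    · simp only [indicator_of_mem hzG, (hz hzG).2.2]
    · simp only [indicator_of_notMem hzG]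
  have hdom : ∀ᵐ z ∂P, ‖G.indicator I z‖ ≤ cN⁻¹ * F (T z) + |S z| + (e z + 1) := by
    filter_upwards [hpt] with z hz
    by_cases hzG : z ∈ G
    · obtain ⟨hlo, hhi, -⟩ := hz hzG
      rw [indicator_of_mem hzG, Real.norm_eq_abs, abs_le]
      have hF0' : 0 ≤ cN⁻¹ * F (T z) := mul_nonneg (inv_nonneg.2 hcN0.le) (hF0 _)
      have he0 : 0 ≤ e z := empiricalEnergyField_one_nonneg z
      constructor
      · linarith [hlo, abs_nonneg (S z), hF0']
      · linarith [hhi, le_abs_self (S z)]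
    · rw [indicator_of_notMem hzG, norm_zero]
      have hF0' : 0 ≤ cN⁻¹ * F (T z) := mul_nonneg (inv_nonneg.2 hcN0.le) (hF0 _)
      have := empiricalEnergyField_one_nonneg z
      positivity
  have hGIint : Integrable (fun z => G.indicator I z) P :=
    Integrable.mono' (((hFTint.const_mul _).add hSint.abs).add (heInt.add (integrable_const _))) hGIm hdom
  refine ⟨hGIint, ?_⟩
  -- Step 4: the bound
  have hGSint : Integrable (fun z => G.indicator S z) P := hSint.indicator hGm
  have hle : ∀ᵐ z ∂P, G.indicator I z ≤ cN⁻¹ * F (T z) + G.indicator S z := by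
    filter_upwards [hpt] with z hz
    by_cases hzG : z ∈ G
    · rw [indicator_of_mem hzG, indicator_of_mem hzG]
      exact (hz hzG).2.1
    · rw [indicator_of_notMem hzG, indicator_of_notMem hzG, add_zero]
      exact mul_nonneg (inv_nonneg.2 hcN0.le) (hF0 _)
  calc ∫ z, G.indicator I z ∂P ≤ ∫ z, (cN⁻¹ * F (T z) + G.indicator S z) ∂P :=
        integral_mono_ae hGIint ((hFTint.const_mul _).add hGSint) hle
    _ = cN⁻¹ * ∫ z, F (T z) ∂P + ∫ z, G.indicator S z ∂P := by
        rw [integral_add (hFTint.const_mul _) hGSint, integral_const_mul]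
    _ ≤ cN⁻¹ * ((klDiv P Gm).toReal + ε * ((N : ℝ) + 1)) + ∫ z, G.indicator S z ∂P := by
        have := mul_le_mul_of_nonneg_left hFTle (inv_nonneg.2 hcN0.le)
        linarith

end Clausius

/-- Registered sub-goal `stub_clausius_core` of the stub `stub_clausius`: the fixed-`N`, fixed-`s`
inequality in mean on the good event (`Clausius.core_bound`). [folklore] -/
theorem stub_clausius_core : ∀ (σ : ℝ), 0 < σ → σ ≤ 1 / 2 → ∀ (a₀ θ₀ : T3 → ℝ) (u₀ : T3 → V3), Continuous a₀ → Continuous θ₀ → Continuous u₀ → (∀ x, 0 < a₀ x) → (∀ x, 0 < θ₀ x) → ∀ (uc : V3) (θc : ℝ), 0 < θc → ∀ (N : ℕ) (Φ : Flow σ N) (c₁ : ℝ), 0 < c₁ → c₁ * σ ^ 3 ≤ 1 → ContinuousOn hsExcessFreeEnergy (Icc (c₁ * σ ^ 3) 1) → ∀ (φ : T3 → ℝ), Continuous φ → (∀ y, 0 ≤ φ y) → ∫ y, φ y = 1 → ∀ Φb : ℝ, (∀ y, φ y ≤ Φb) → Φb < ((N + 1 : ℕ) : ℝ) * c₁ →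 ∀ γ' ε : ℝ, 0 < γ' → ∫⁻ z, ENNReal.ofReal (Real.exp (γ' * ((N : ℝ) + 1) * {z : Config (N + 1) (Fin 3) T3 | ∀ x, c₁ ≤ bρ φ z x ∧ bρ φ z x * σ ^ 3 ≤ 1}.indicator (fun z => ∫ x, max 0 (relEnt σ (bU φ z x) (stateOf 1 uc θc))) z)) ∂(localGibbsLaw σ (fun _ => 1) (fun _ => uc) (fun _ => θc) N Φ) ≤ ENNReal.ofReal (Real.exp (ε * ((N : ℝ) + 1))) → ∀ (G : Set (Config (N + 1) (Fin 3) T3)), MeasurableSet G → G ⊆ Φ.good → ∀ s : ℝ, (∀ z ∈ G, ∀ x, c₁ ≤ bρ φ (Φ.flow s z) x ∧ bρ φ (Φ.flow s z) x * σ ^ 3 ≤ 1) → Integrable (fun z => G.indicator (fun z => ∫ x, hsEntropy σ (bU φ (Φ.flow s z) x)) z) (localGibbsLaw σ a₀ u₀ θ₀ N Φ) ∧ ∫ z, G.indicator (fun z => ∫ x, hsEntropy σ (bU φ (Φ.flow s z) x)) z ∂(localGibbsLaw σ a₀ u₀ θ₀ N Φ) ≤ (γ' * ((N : ℝ) + 1))⁻¹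 * ((klDiv (localGibbsLaw σ a₀ u₀ θ₀ N Φ) (localGibbsLaw σ (fun _ => 1) (fun _ => uc) (fun _ => θc) N Φ)).toReal + ε * ((N : ℝ) + 1)) + ∫ z, G.indicator (fun z => hsEntropy σ (stateOf 1 uc θc) + fderiv ℝ (hsEntropy σ) (stateOf 1 uc θc) ((((1 : ℝ), empiricalMomentumField z (fun _ => (1 : ℝ)), empiricalEnergyField z (fun _ => (1 : ℝ))) : State) - stateOf 1 uc θc)) z ∂(localGibbsLaw σ a₀ u₀ θ₀ N Φ) :=
  fun _ hσ hσ2 _ _ _ ha hθ hu ha0 hθ0 uc _ hθc _ Φ _ hc₁ hc₁σ hfex _ hφc hφ0 hφ1 _ hφb hN _ _ hγ' hMGF _ hGm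
      hGgood s hGband =>
    Clausius.core_bound hσ hσ2 ha hθ hu ha0 hθ0 uc hθc Φ hc₁ hc₁σ hfex hφc hφ0 hφ1 hφb hN hγ' hMGF hGm hGgood s
      hGband

end Barycentric

end Summit.AtomisticToContinuum.HydrodynamicLimit.Theorems.MacroClosureLine

end
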